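import Summits.QuantumFields.BalabanUV.Beta.GAN24.Lin4ParityCovariance
import Summits.QuantumFields.BalabanUV.Beta.CombChartWardSockets
import Summits.QuantumFields.BalabanUV.Beta.SymSecondOrderTablesAn1

/-!
# `BalabanUV.Beta.GAN24.CombAffineUnrollProjected` — binder row G-an2-4 ∕ (CONV-C), TRANSFER-III: **LINK L8a OF THE (α-0) CHAIN AT ROW D1's LITERAL OF RECORD (III′)
# — (α-END-a) «THE EVEN HSPLIT» FOR THE COMB-CHART `T₂` TOWER, HYPOTHESIS-FREE.**  For ANY sym table record `tabs : SymTables d Lc` with an off-diagonal second-order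
# border (`tabs.vh₂S`'s field–field and multiplier–multiplier blocks vanish — displayed; for an1's record `symTablesAn1S2 d Lc cΛ` by `rfl`), every `cE cVH cΛ cE₂ cB`, initial
# table `Tc`, every `c ε n`: the halved member `y_n := c • (T̃′_n + ε • P T̃′_n)` of the comb-chart unit `T₂` tower `T̃′_j = unitS₂_j (T2RecOf d Lc (GcombSh Lc) (SpureCombOf tabs …)
# tabs.M cE₂ cB Tc tabs.vh₂S tabs.mixFF j)` satisfies road W3's `hsplit` through the UNDRESSED transport `𝒯^B`, `B j = lin4 c₄ (unitK_j (KInvStep Lc j)) Lc`, with sources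
# `c • (b̃′_l + ε • P b̃′_l)` and cells `𝒜^{G′}_l y_l − 𝒜^K_l y_l` — leaf-01 g71's slot-generic `AffineUnrollProjected.unitS₂_T2RecOf_half_eq_transportB_add_sum_cell_of_letters` at the sym ∕
# comb slot data `(GcombSh Lc, KInvStep Lc, SpureCombOf tabs …, tabs.M, tabs.vh₂S, tabs.mixFF)`, its ONE displayed commutation `hpA` DISCHARGED by leaf-01 g71's generic
# `Lin4ParityCovariance.sgnK_trK_lin4` at the comb-chart resolvent (`G′_j` decaying ∕ sgn-symmetric: an2's `decays_GcombSh` ∕ `trK_GcombSh`; units by leaf-03's `trK_unitK_eq_sgnK`)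
# — the (III′) twin of leaf-01 g71's `Lin4ParityCovariance.unitS₂_T2RecAt_half_eq_transportB_add_sum_cell'` (there: (E), `Ĝ_j = coDressKBmAt ρ Lc (KInvStep Lc j)`)
# (OWNER of row G-an2-4, unit `b2b-balaban-gan24-p1` gen 46 — both (E) parents are leaf-01 g71's files for MY gen-33 (α-END) INTENT piece (α-END-a); no existing file touched)

NOT IN PRINT; OUR BOOKKEEPING ([folklore] composition BY NAME; 0 `def`, 0 cited fact, 0 `def … : Prop`, 0 sorry).  HONEST FRAMING (cell contract, verbatim): «discharging
`BetaPertH` makes Bałaban's UV stability UNCONDITIONAL — a real constructive-QFT result; it is NOT the continuum limit and NOT the Clay problem.»  HONEST DEPENDENCY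
(verbatim): «continuum YM on T⁴ ⇐ BetaPertH ∧ nine spine estimates (0/9 proved); BetaPertH ⇐ (D1) ∧ (D4) ∧ CAP+tail; G-an2-4 gates asym, D1 and NE2/3/4.»

WHY (OWNER link table R-gan24p1-g46-2, row L8a «GENERIC over `T2RecOf`-type recursions — by name»): this file is that «by name» made a tree line, so that the (III′)
twins of L8c ∕ L8c′ («T2Shape^ε» ∕ «T2Drift^ε» ⟸ source rows, road-P2's `T2HybridShapeEnd.shape_three_of_hyb_rows` UNCHANGED) can quote their `hsplit` for the comb chart.
The CELLS `𝒜^{G′}_l − 𝒜^K_l` at (III′) carry the two co-dressings AND the symmetrised corrector (`GcombSh = Ψ̂_S ∘ coDressKBmAt ρ_c (KInvStep) ∘ Ψ̂_Sᵀ`, an2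
`CombChartTransportLevel`) — their source rows are the (III′) campaign's NEW content and are NOT touched here.

CONTENT (generic `d`, `Lc ≥ 1` via `[NeZero Lc]`; `c₄ = cE₂·Lc^{2(d+1)}`; `P T κ u κ′ u′ := sgnK (trK (T κ u κ′ u′))`).
* §1 `sgnK_trK_lin4_unitK_GcombSh` — `P` commutes with the DRESSED comb-chart unit step `lin4 c (unitK sf sm (GcombSh Lc j)) Lc` on bounded bi-tables (any units, any `c`).
* §2 **`unitS₂_T2RecOf_comb_half_eq_transportB_add_sum_cell`** — the even ∕ odd hsplit for the comb-chart `T₂` tower, any sym record with off-diagonal border (two displayed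
  block-vanishing letters `hBff hBmm` on `tabs.vh₂S`), NO other hypothesis.
* §3 **`unitS₂_T2RecOf_comb_half_eq_transportB_add_sum_cell_an1`** — the same at an1's record `symTablesAn1S2 d Lc cΛ`, `hBff hBmm` DISCHARGED (`symVh₂SAn1_inl_inl ∕ _inr_inr`, `rfl`).
WHAT THIS IS NOT.  An IDENTITY only: no source row, no cell row, no shape ∕ drift END (L8c ∕ L8c′), no value; NEVER «G-an2-4 closed» as (CONV-C); NOT D1, NOT `BetaPertH`, NOT continuum,
NOT Clay.  2026-08-25.
-/

noncomputable section

open Finset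
open scoped BigOperators
open Literature.MathematicalPhysics.QuantumFieldTheory
open Literature.MathematicalPhysics.QuantumFieldTheory.Balaban1983to89
open Literature.MathematicalPhysics.QuantumFieldTheory.Balaban1983to89.Beta
open ExpKernelCalculus (MKer Decays)
open OneStepResolventKernel (Fib LocStencil)
open OneStepKernelFamily (KInvStep decays_KInvStep)
open AveragingContoursRooted (ctr)
open SecondOrderResponse (W2SymOfK)
open BalabanStepJetsSucc (mmRead)
open BalabanStepW2 (K3OfK M2Of)
open Summit.QuantumFields.BalabanUV.Beta.TameKernelCalculus (trK)
open Summit.QuantumFields.BalabanUV.Beta.BorderedHessian (sgnK)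
open Summit.QuantumFields.BalabanUV.Beta.HessKerDressedUnits (unitK unitS decays_unitK)
open Summit.QuantumFields.BalabanUV.Beta.SecondOrderUnits (unitM unitS₂ unitM₂)
open Summit.QuantumFields.BalabanUV.Beta.SpineRooted (T2RecOf)
open Summit.QuantumFields.BalabanUV.Beta.SymmetrisedStepJets (SymTables)
open Summit.QuantumFields.BalabanUV.Beta.CombChartStepJets (GcombSh decays_GcombSh SpureCombOf locStencil_SpureCombOf)
open Summit.QuantumFields.BalabanUV.Beta.CombChartWardSockets (trK_GcombSh)
open Summit.QuantumFields.BalabanUV.Beta.SymSecondOrderTablesAn1 (symTablesAn1S2)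
open Summit.QuantumFields.BalabanUV.Beta.GAN24.CombesThomas (sfStep smStep)
open Summit.QuantumFields.BalabanUV.Beta.GAN24.T2RecursionAffine (lin4)
open Summit.QuantumFields.BalabanUV.Beta.GAN24.AffineUnroll (transport)
open Summit.QuantumFields.BalabanUV.Beta.GAN24.LayerCommutatorAntisymm (trK_unitK_eq_sgnK)
open Summit.QuantumFields.BalabanUV.Beta.GAN24.Lin4ParityCovariance (sgnK_trK_lin4)
open Summit.QuantumFields.BalabanUV.Beta.GAN24.AffineUnrollProjected (unitS₂_T2RecOf_half_eq_transportB_add_sum_cell_of_letters)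

namespace Summit.QuantumFields.BalabanUV.Beta.GAN24.CombAffineUnrollProjected

variable {d : ℕ} {Lc : ℕ} [NeZero Lc]

/-! ## §1 The slotwise parity commutes with the dressed comb-chart unit step -/

/-- [folklore] **`P := sgnK ∘ trK` COMMUTES WITH THE DRESSED COMB-CHART UNIT STEP** `lin4 c (unitK sf sm (GcombSh Lc j)) Lc` on bounded bi-tables (any units `sf sm`, any `c`):
leaf-01 g71's generic `Lin4ParityCovariance.sgnK_trK_lin4` at the comb-chart resolvent — decaying by an2's `CombChartStepJets.decays_GcombSh` (units: asym1's `decays_unitK`),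
sgn-symmetric by an2's `CombChartWardSockets.trK_GcombSh` (units: leaf-03's `trK_unitK_eq_sgnK`). -/
theorem sgnK_trK_lin4_unitK_GcombSh (j : ℕ) (sf sm c : ℝ)
    (X : Fin (d + 1) → (Fin (d + 1) → ℤ) → Fin (d + 1) → (Fin (d + 1) → ℤ) → MKer (d + 1) (Fib d))
    (hX : ∃ B : ℝ, ∀ κ u κ' u' x z a b, |X κ u κ' u' x z a b| ≤ B) :
    (fun κ u κ' u' => sgnK (trK (lin4 c (unitK sf sm (GcombSh (d := d) Lc j)) Lc X κ u κ' u'))) =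
      lin4 c (unitK sf sm (GcombSh (d := d) Lc j)) Lc (fun κ u κ' u' => sgnK (trK (X κ u κ' u'))) := by
  obtain ⟨δ, C, hδ, -, hK⟩ := decays_GcombSh (d := d) Lc j
  exact sgnK_trK_lin4 (decays_unitK (sf := sf) (sm := sm) hK) hδ (trK_unitK_eq_sgnK (trK_GcombSh (d := d) (Lc := Lc) j) sf sm) c Lc hX

/-! ## §2 (α-END-a) «THE EVEN HSPLIT» for the comb-chart `T₂` tower, any sym record with off-diagonal border -/

/-- **LINK L8a AT (III′): THE EVEN ∕ ODD HSPLIT OF THE COMB-CHART UNIT `T₂` TOWER, HYPOTHESIS-FREE UP TO THE BORDER's TWO BLOCK-VANISHING LETTERS** [our bookkeeping;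
folklore composition] (generic `d`, `Lc ≥ 1`, any `tabs : SymTables d Lc`, all `cE cVH cΛ cE₂ cB Tc`, every `c ε n`; `T̃′_j := unitS₂_j (T2RecOf d Lc (GcombSh Lc) (SpureCombOf tabs cE cVH cΛ)
tabs.M cE₂ cB Tc tabs.vh₂S tabs.mixFF j)`, `G′_j := GcombSh Lc j`, `K_j := KInvStep Lc j`, `c₄ := cE₂·Lc^{2(d+1)}`):
`c • (T̃′_n + ε • P T̃′_n) = 𝒯^B(0,n) (c • (T̃′_0 + ε • P T̃′_0)) + Σ_{l<n} 𝒯^B(l+1,n−1−l) (c • (b̃′_l + ε • P b̃′_l) + (𝒜^{G′}_l y_l − 𝒜^K_l y_l))`, `y_l = c • (T̃′_l + ε • P T̃′_l)` —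
leaf-01 g71's `AffineUnrollProjected.unitS₂_T2RecOf_half_eq_transportB_add_sum_cell_of_letters` at the sym ∕ comb slot data, letters from the record (`tabs.hM ∕ hB ∕ hmix`) and an2's
`decays_GcombSh` ∕ `locStencil_SpureCombOf` ∕ `decays_KInvStep`, `hpA := §1`. -/
theorem unitS₂_T2RecOf_comb_half_eq_transportB_add_sum_cell (tabs : SymTables d Lc) (cE cVH cΛ cE₂ cB : ℝ) (Tc : Fin 4 → Fin 4 → Fin 4 → Fin 4 → ℝ)
    (hBff : ∀ κ u κ' u' x z (α β : Fin (d + 1)), tabs.vh₂S κ u κ' u' x z (Sum.inl α) (Sum.inl β) = 0)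
    (hBmm : ∀ κ u κ' u' x z (μ ν : Fin (d + 1)), tabs.vh₂S κ u κ' u' x z (Sum.inr μ) (Sum.inr ν) = 0)
    (c ε : ℝ) (n : ℕ) :
    c • (unitS₂ (sfStep Lc n) (smStep d Lc n) (T2RecOf d Lc (GcombSh Lc) (SpureCombOf tabs cE cVH cΛ) tabs.M cE₂ cB Tc tabs.vh₂S tabs.mixFF n) +
        ε • fun κ u κ' u' => sgnK (trK (unitS₂ (sfStep Lc n) (smStep d Lc n)
          (T2RecOf d Lc (GcombSh Lc) (SpureCombOf tabs cE cVH cΛ) tabs.M cE₂ cB Tc tabs.vh₂S tabs.mixFF n) κ u κ' u'))) =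
      transport (fun j => lin4 (cE₂ * (Lc : ℝ) ^ (2 * (d + 1))) (unitK (sfStep Lc j) (smStep d Lc j) (KInvStep (d := d) Lc j)) Lc) 0 n
          (c • (unitS₂ (sfStep Lc 0) (smStep d Lc 0) (T2RecOf d Lc (GcombSh Lc) (SpureCombOf tabs cE cVH cΛ) tabs.M cE₂ cB Tc tabs.vh₂S tabs.mixFF 0) +
            ε • fun κ u κ' u' => sgnK (trK (unitS₂ (sfStep Lc 0) (smStep d Lc 0)
              (T2RecOf d Lc (GcombSh Lc) (SpureCombOf tabs cE cVH cΛ) tabs.M cE₂ cB Tc tabs.vh₂S tabs.mixFF 0) κ u κ' u')))) +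
        ∑ l ∈ Finset.range n, transport (fun j => lin4 (cE₂ * (Lc : ℝ) ^ (2 * (d + 1))) (unitK (sfStep Lc j) (smStep d Lc j) (KInvStep (d := d) Lc j)) Lc) (l + 1) (n - 1 - l)
          (c • ((fun κ u κ' u' => (cE₂ * (Lc : ℝ) ^ (2 * (d + 1))) • mmRead Lc (K3OfK (unitK (sfStep Lc l) (smStep d Lc l) (GcombSh (d := d) Lc l)) Lc
              (unitS (sfStep Lc l) (smStep d Lc l) (SpureCombOf tabs cE cVH cΛ l)) (unitM (sfStep Lc l) (smStep d Lc l) (tabs.M l)) (W2SymOfK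
              (unitK (sfStep Lc l) (smStep d Lc l) (GcombSh (d := d) Lc l)) Lc (unitS (sfStep Lc l) (smStep d Lc l) (SpureCombOf tabs cE cVH cΛ l))
              (unitM (sfStep Lc l) (smStep d Lc l) (tabs.M l)) 0
              (unitM₂ (sfStep Lc l) (smStep d Lc l) (M2Of d Lc tabs.mixFF l))) κ u κ' u') + cB • tabs.vh₂S κ u κ' u') +
            ε • fun κ u κ' u' => sgnK (trK ((fun κ u κ' u' => (cE₂ * (Lc : ℝ) ^ (2 * (d + 1))) • mmRead Lc (K3OfK (unitK (sfStep Lc l) (smStep d Lc l) (GcombSh (d := d) Lc l)) Lc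
              (unitS (sfStep Lc l) (smStep d Lc l) (SpureCombOf tabs cE cVH cΛ l)) (unitM (sfStep Lc l) (smStep d Lc l) (tabs.M l)) (W2SymOfK
              (unitK (sfStep Lc l) (smStep d Lc l) (GcombSh (d := d) Lc l)) Lc (unitS (sfStep Lc l) (smStep d Lc l) (SpureCombOf tabs cE cVH cΛ l))
              (unitM (sfStep Lc l) (smStep d Lc l) (tabs.M l)) 0
              (unitM₂ (sfStep Lc l) (smStep d Lc l) (M2Of d Lc tabs.mixFF l))) κ u κ' u') + cB • tabs.vh₂S κ u κ' u') κ u κ' u'))) +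
           (lin4 (cE₂ * (Lc : ℝ) ^ (2 * (d + 1))) (unitK (sfStep Lc l) (smStep d Lc l) (GcombSh (d := d) Lc l)) Lc
              (c • (unitS₂ (sfStep Lc l) (smStep d Lc l) (T2RecOf d Lc (GcombSh Lc) (SpureCombOf tabs cE cVH cΛ) tabs.M cE₂ cB Tc tabs.vh₂S tabs.mixFF l) +
                ε • fun κ u κ' u' => sgnK (trK (unitS₂ (sfStep Lc l) (smStep d Lc l)
                  (T2RecOf d Lc (GcombSh Lc) (SpureCombOf tabs cE cVH cΛ) tabs.M cE₂ cB Tc tabs.vh₂S tabs.mixFF l) κ u κ' u')))) -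
            lin4 (cE₂ * (Lc : ℝ) ^ (2 * (d + 1))) (unitK (sfStep Lc l) (smStep d Lc l) (KInvStep (d := d) Lc l)) Lc
              (c • (unitS₂ (sfStep Lc l) (smStep d Lc l) (T2RecOf d Lc (GcombSh Lc) (SpureCombOf tabs cE cVH cΛ) tabs.M cE₂ cB Tc tabs.vh₂S tabs.mixFF l) +
                ε • fun κ u κ' u' => sgnK (trK (unitS₂ (sfStep Lc l) (smStep d Lc l)
                  (T2RecOf d Lc (GcombSh Lc) (SpureCombOf tabs cE cVH cΛ) tabs.M cE₂ cB Tc tabs.vh₂S tabs.mixFF l) κ u κ' u')))))) :=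
  unitS₂_T2RecOf_half_eq_transportB_add_sum_cell_of_letters (fun j => GcombSh (d := d) Lc j) (fun j => KInvStep (d := d) Lc j)
    (SpureCombOf tabs cE cVH cΛ) tabs.M cE₂ cB Tc (vh₂S := tabs.vh₂S) (mixFF := tabs.mixFF) (NeZero.one_le) hBff hBmm
    (decays_GcombSh (d := d) Lc) (fun j => decays_KInvStep (d := d) (Lc := Lc) j) (locStencil_SpureCombOf tabs cE cVH cΛ) tabs.hM tabs.hB tabs.hmix
    (fun j X hX => sgnK_trK_lin4_unitK_GcombSh j (sfStep Lc j) (smStep d Lc j) (cE₂ * (Lc : ℝ) ^ (2 * (d + 1))) X hX) c ε n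

/-! ## §3 an1's record: the border's two block-vanishing letters discharged -/

/-- **LINK L8a AT (III′) FOR an1's RECORD `symTablesAn1S2 d Lc cΛt`, HYPOTHESIS-FREE** [our bookkeeping; folklore composition]: §2 with `hBff ∕ hBmm` DISCHARGED — the record's
border table is an1's `symVh₂SAn1 d Lc`, whose field–field and multiplier–multiplier blocks vanish by `rfl` (`SymSecondOrderTablesAn1.symVh₂SAn1_inl_inl ∕ _inr_inr`). -/
theorem unitS₂_T2RecOf_comb_half_eq_transportB_add_sum_cell_an1 (cΛt cE cVH cΛ cE₂ cB : ℝ) (Tc : Fin 4 → Fin 4 → Fin 4 → Fin 4 → ℝ) (c ε : ℝ) (n : ℕ) :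
    c • (unitS₂ (sfStep Lc n) (smStep d Lc n) (T2RecOf d Lc (GcombSh Lc) (SpureCombOf (symTablesAn1S2 d Lc cΛt) cE cVH cΛ) (symTablesAn1S2 d Lc cΛt).M cE₂ cB Tc
          (symTablesAn1S2 d Lc cΛt).vh₂S (symTablesAn1S2 d Lc cΛt).mixFF n) +
        ε • fun κ u κ' u' => sgnK (trK (unitS₂ (sfStep Lc n) (smStep d Lc n)
          (T2RecOf d Lc (GcombSh Lc) (SpureCombOf (symTablesAn1S2 d Lc cΛt) cE cVH cΛ) (symTablesAn1S2 d Lc cΛt).M cE₂ cB Tc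
            (symTablesAn1S2 d Lc cΛt).vh₂S (symTablesAn1S2 d Lc cΛt).mixFF n) κ u κ' u'))) =
      transport (fun j => lin4 (cE₂ * (Lc : ℝ) ^ (2 * (d + 1))) (unitK (sfStep Lc j) (smStep d Lc j) (KInvStep (d := d) Lc j)) Lc) 0 n
          (c • (unitS₂ (sfStep Lc 0) (smStep d Lc 0) (T2RecOf d Lc (GcombSh Lc) (SpureCombOf (symTablesAn1S2 d Lc cΛt) cE cVH cΛ) (symTablesAn1S2 d Lc cΛt).M cE₂ cB Tc
              (symTablesAn1S2 d Lc cΛt).vh₂S (symTablesAn1S2 d Lc cΛt).mixFF 0) +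
            ε • fun κ u κ' u' => sgnK (trK (unitS₂ (sfStep Lc 0) (smStep d Lc 0)
              (T2RecOf d Lc (GcombSh Lc) (SpureCombOf (symTablesAn1S2 d Lc cΛt) cE cVH cΛ) (symTablesAn1S2 d Lc cΛt).M cE₂ cB Tc
                (symTablesAn1S2 d Lc cΛt).vh₂S (symTablesAn1S2 d Lc cΛt).mixFF 0) κ u κ' u')))) +
        ∑ l ∈ Finset.range n, transport (fun j => lin4 (cE₂ * (Lc : ℝ) ^ (2 * (d + 1))) (unitK (sfStep Lc j) (smStep d Lc j) (KInvStep (d := d) Lc j)) Lc) (l + 1) (n - 1 - l)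
          (c • ((fun κ u κ' u' => (cE₂ * (Lc : ℝ) ^ (2 * (d + 1))) • mmRead Lc (K3OfK (unitK (sfStep Lc l) (smStep d Lc l) (GcombSh (d := d) Lc l)) Lc
              (unitS (sfStep Lc l) (smStep d Lc l) (SpureCombOf (symTablesAn1S2 d Lc cΛt) cE cVH cΛ l)) (unitM (sfStep Lc l) (smStep d Lc l) ((symTablesAn1S2 d Lc cΛt).M l))
              (W2SymOfK (unitK (sfStep Lc l) (smStep d Lc l) (GcombSh (d := d) Lc l)) Lc (unitS (sfStep Lc l) (smStep d Lc l) (SpureCombOf (symTablesAn1S2 d Lc cΛt) cE cVH cΛ l))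
              (unitM (sfStep Lc l) (smStep d Lc l) ((symTablesAn1S2 d Lc cΛt).M l)) 0
              (unitM₂ (sfStep Lc l) (smStep d Lc l) (M2Of d Lc (symTablesAn1S2 d Lc cΛt).mixFF l))) κ u κ' u') + cB • (symTablesAn1S2 d Lc cΛt).vh₂S κ u κ' u') +
            ε • fun κ u κ' u' => sgnK (trK ((fun κ u κ' u' => (cE₂ * (Lc : ℝ) ^ (2 * (d + 1))) • mmRead Lc (K3OfK (unitK (sfStep Lc l) (smStep d Lc l) (GcombSh (d := d) Lc l)) Lc
              (unitS (sfStep Lc l) (smStep d Lc l) (SpureCombOf (symTablesAn1S2 d Lc cΛt) cE cVH cΛ l)) (unitM (sfStep Lc l) (smStep d Lc l) ((symTablesAn1S2 d Lc cΛt).M l))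
              (W2SymOfK (unitK (sfStep Lc l) (smStep d Lc l) (GcombSh (d := d) Lc l)) Lc (unitS (sfStep Lc l) (smStep d Lc l) (SpureCombOf (symTablesAn1S2 d Lc cΛt) cE cVH cΛ l))
              (unitM (sfStep Lc l) (smStep d Lc l) ((symTablesAn1S2 d Lc cΛt).M l)) 0
              (unitM₂ (sfStep Lc l) (smStep d Lc l) (M2Of d Lc (symTablesAn1S2 d Lc cΛt).mixFF l))) κ u κ' u') + cB • (symTablesAn1S2 d Lc cΛt).vh₂S κ u κ' u') κ u κ' u'))) +
           (lin4 (cE₂ * (Lc : ℝ) ^ (2 * (d + 1))) (unitK (sfStep Lc l) (smStep d Lc l) (GcombSh (d := d) Lc l)) Lc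
              (c • (unitS₂ (sfStep Lc l) (smStep d Lc l) (T2RecOf d Lc (GcombSh Lc) (SpureCombOf (symTablesAn1S2 d Lc cΛt) cE cVH cΛ) (symTablesAn1S2 d Lc cΛt).M cE₂ cB Tc
                  (symTablesAn1S2 d Lc cΛt).vh₂S (symTablesAn1S2 d Lc cΛt).mixFF l) +
                ε • fun κ u κ' u' => sgnK (trK (unitS₂ (sfStep Lc l) (smStep d Lc l)
                  (T2RecOf d Lc (GcombSh Lc) (SpureCombOf (symTablesAn1S2 d Lc cΛt) cE cVH cΛ) (symTablesAn1S2 d Lc cΛt).M cE₂ cB Tc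
                    (symTablesAn1S2 d Lc cΛt).vh₂S (symTablesAn1S2 d Lc cΛt).mixFF l) κ u κ' u')))) -
            lin4 (cE₂ * (Lc : ℝ) ^ (2 * (d + 1))) (unitK (sfStep Lc l) (smStep d Lc l) (KInvStep (d := d) Lc l)) Lc
              (c • (unitS₂ (sfStep Lc l) (smStep d Lc l) (T2RecOf d Lc (GcombSh Lc) (SpureCombOf (symTablesAn1S2 d Lc cΛt) cE cVH cΛ) (symTablesAn1S2 d Lc cΛt).M cE₂ cB Tc
                  (symTablesAn1S2 d Lc cΛt).vh₂S (symTablesAn1S2 d Lc cΛt).mixFF l) +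
                ε • fun κ u κ' u' => sgnK (trK (unitS₂ (sfStep Lc l) (smStep d Lc l)
                  (T2RecOf d Lc (GcombSh Lc) (SpureCombOf (symTablesAn1S2 d Lc cΛt) cE cVH cΛ) (symTablesAn1S2 d Lc cΛt).M cE₂ cB Tc
                    (symTablesAn1S2 d Lc cΛt).vh₂S (symTablesAn1S2 d Lc cΛt).mixFF l) κ u κ' u')))))) :=
  unitS₂_T2RecOf_comb_half_eq_transportB_add_sum_cell (symTablesAn1S2 d Lc cΛt) cE cVH cΛ cE₂ cB Tc (fun _ _ _ _ _ _ _ _ => rfl) (fun _ _ _ _ _ _ _ _ => rfl) c ε n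

end Summit.QuantumFields.BalabanUV.Beta.GAN24.CombAffineUnrollProjected

end
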